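import Summits.QuantumFields.YangMills.Theorems.BalabanUVNodesN07LieTokAtUnitFieldTwo
import HarnessLib

/-!
# NODE N07 → K0ᴬ — def-Y's TOKEN `WAnalyticTok` («`(δ∕δA′)V` is analytic on `{‖Y‖ < a₃}`») IS LIT's ✓`analyticOnNhd_W80_lt` UNDER THE SAME SECT. C ROWS the reality ∕ trace programme
# displays (`Regime H♭ 0 C^{𝔰𝔩} b 0 C₂ c₄ 0 a_C ε_C`, `Prop4Hyp C^{𝔰𝔩} C₂ c₄`, `a₃ ≤ a_C`) — every `N`, every background; hence at the flat scheme of record (`N = 2`) BOTH analytic letters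
# `hWtok`, `htok` of ✓`…K0AxTangentSocketOnto.rootedReceipts_of_tokens_atScale_recordScheme` come from ONE displayed Sect. C package (+ `RegimeTok`, `dom ∈ 𝓝 1`, chart letter, `G′` row,
# `Delta2Tok ∧ Delta2SymmTok`, `hCreal`∕`hCtr`); and the `G′` row is discharged for print's own `G′ = (Δ_{U₀} + a′·proj_{N(Q′♭)ᗮ})⁻¹` ([15] Prop. 4 p. 292, (80) p. 290, Prop. 6 p. 295; [B9] (3.24)–(3.25))

Cell `pub-ymgap`, width seat `pub-ymgap-dag-n07-w3` (g27), CLAIM-10.  `--kind proof --supports stmt-QuantumFields-27238 --as helper`; count-neutral.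
[15] = [Balaban1985Variational]; [B9] = [Balaban1985BackgroundPropagators].

CONTENTS.
* §1 ★`wAnalyticTok_of_sectCRegime` — `Regime H♭ 0 C^{𝔰𝔩} … a_C ε_C` + `Prop4Hyp` + `a₃ ≤ a_C` ⟹ `WAnalyticTok … ε_C a₃` (lit ✓`B11Eq80Current.analyticOnNhd_W80_lt` at def-Y's letters; any `N`, `U₀`).
* §2 ★★`htok_and_hWtok_ofRecord_two_of_tok` — at `U₀ = 1`, `N = 2`: the pair (`hWtok`, `htok`) of the (R-a) road from the displayed package (✓`eventually_lieTokAt_unitField_ofRecord_two_of_tok` + §1).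
* §3 ★★`eventually_lieTokAt_unitField_ofRecord_two_printGreen` — the same `htok` with the `G′` row DISCHARGED for print's concrete `G′` (✓`printGreenOfRecord_starW`, ✓`scalPartW_printGreenOfRecord`).

HONEST LABELS.  By-name assembly; Sect. C's regime ∕ `Prop4Hyp` (Bałaban's Prop. 3–4 estimates), `RegimeTok`, `hCreal`∕`hCtr` stay DISPLAYED; `N = 2` for §2–§3.  Count-neutral; K0ᴬ NOT closed;
N07 NOT discharged; P0 ⟨26900⟩ OPEN; R4 is the conditional finite-𝕋⁴ rung only.  Nothing here is a claim about the Yang–Mills mass gap (`Summit.QuantumFields`): finite torus, fixed `ε`;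
nothing continuum ∕ OS ∕ Clay.
-/

set_option autoImplicit false

noncomputable section

open Filter Topology
open scoped Matrix Matrix.Norms.L2Operator InnerProductSpace ComplexConjugate

namespace Summit.QuantumFields.YangMills.Theorems.N07WAnalyticTokOfSectC

open Literature.MathematicalPhysics.QuantumFieldTheory.Balaban1983to89
open Literature.MathematicalPhysics.QuantumFieldTheory.Balaban1983to89.T4Continuum (T4Family)
open Literature.MathematicalPhysics.QuantumFieldTheory.Balaban1983to89.Node00
open T4Continuum BlockAveraging
open B9Eq311TracePairing (starW)
open B11Eq103H1Complex (BondL2K SiteL2K covLaplaceSiteK greenK)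
open B11Eq111FrakG (nabla115)
open B11Eq115Space (NegSize NegSup levWeight JetSup)
open B11Eq174Chart (Regime)
open B11Prop6Scheme (Prop4Hyp)
open B11Eq80Current (analyticOnNhd_W80_lt)
open NormedSpace (exp)
open Summit.QuantumFields.YangMills.Theorems.K0RecordFormatNames
open Summit.QuantumFields.YangMills.Theorems.N07TraceSectorDefs (scalPartW)
open Summit.QuantumFields.YangMills.Theorems.N07FrakGOfRecordReality (printGreenOfRecord_starW)
open Summit.QuantumFields.YangMills.Theorems.N07SlotCTraceSectors (scalPartW_printGreenOfRecord)
open Summit.QuantumFields.YangMills.Theorems.N07LieTokAtUnitFieldTwo (eventually_lieTokAt_unitField_ofRecord_two eventually_lieTokAt_unitField_ofRecord_two_of_tok)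

/-! ## §1  `WAnalyticTok` from the Sect. C rows -/

section AnyN

variable (F : T4Family) (N : ℕ) [NeZero N] (K : ℕ) (k : ℕ) (Ω : ℕ → Set (Site (F.P K) 0)) (U₀ : GaugeField (F.P K) 0 (SU N))
  [Fact (0 < (F.L : ℝ))] [Fact (0 < (F.P K).eta k)] [Fact (0 < c0Rec F K k)] [Fact (∀ c, 0 < wBRec F K k c)]
  (levB : PBond (F.P K) k → ℕ)
  (Gp : SiteL2K ℂ (F.P K).d (fun _ => (F.P K).sitesPerDir 0) (c0Rec F K k) (WRec N) →ₗ[ℂ]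
    SiteL2K ℂ (F.P K).d (fun _ => (F.P K).sitesPerDir 0) (c0Rec F K k) (WRec N)) (a : ℝ)
  (hposb : ∀ x, x ≠ 0 → 0 < RCLike.re ⟪x, laplaceAOfRecord F N k U₀ (QOfRecord F N k U₀) (QflatOfRecord F N k) a x⟫_ℂ)
  (hQ : Function.Surjective (QOfRecord F N k U₀)) {b C₂ c₄ aC : ℝ} (εC a₃ : ℝ)

/-- ★ **def-Y's `WAnalyticTok` FROM SECT. C's ROWS**: `Regime H♭ 0 C^{𝔰𝔩} b 0 C₂ c₄ 0 a_C ε_C`, `Prop4Hyp C^{𝔰𝔩} C₂ c₄` and `a₃ ≤ a_C` give «`W = (δ∕δA′)V` analytic on `{‖Y‖ < a₃}`» for the scheme of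
record's `W := WOfRecordAt levB a hpos♭ hQ ε_C G′` (lit ✓`analyticOnNhd_W80_lt`: the (47) fixed point is holomorphic, Prop. 3, hence so are `HD`, `HD₃`, the transposed currents and the `V₀`-group).
[cite: Balaban1985Variational, Prop. 4 p.292, Prop. 3 p.289, (80) p.290, (84)–(96) pp.290–292] -/
theorem wAnalyticTok_of_sectCRegime (RC : Regime (H1OfRecordAtBgFlat F N K k Ω U₀ levB a hposb hQ) 0 (CslOfRecord F N K k Ω U₀ levB) b 0 C₂ c₄ 0 aC εC)
    (hP : Prop4Hyp (CslOfRecord F N K k Ω U₀ levB) C₂ c₄) (haC : a₃ ≤ aC) : WAnalyticTok F N K k Ω U₀ levB Gp a hposb hQ εC a₃ := by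
  haveI : CompleteSpace (NegSize (F.L : ℝ) ((F.P K).eta k) levB 0 (Matrix (Fin N) (Fin N) ℂ)) := FiniteDimensional.complete ℂ _
  unfold WAnalyticTok WOfRecordAt
  exact analyticOnNhd_W80_lt (rhoRec N) (tauRecCLM N) (unitsOfRecord F N U₀) RC hP (JOfRecordAtBg F N K k Ω U₀)
    (DeltaPiCurOfRecord F N K k Ω U₀ Gp (QflatOfRecord F N k)) haC

end AnyN

/-! ## §2  Both analytic letters of the (R-a) road at the flat scheme of record, `N = 2` -/

section Record

variable (F : T4Family) (θ : Stage13Params F 2) (k K : ℕ) [Fact (0 < (F.L : ℝ))] [Fact (0 < (F.P K).eta (k + 1))] [Fact (0 < c0Rec F K (k + 1))]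
  [Fact (∀ c, 0 < wBRec F K (k + 1) c)]
  (Ω : ℕ → Set (Site (F.P K) 0)) (dom : Set (GaugeField (F.P K) (k + 1) (SU 2))) (levB : PBond (F.P K) (k + 1) → ℕ)
  {Gp : SiteL2K ℂ (F.P K).d (fun _ => (F.P K).sitesPerDir 0) (c0Rec F K (k + 1)) (WRec 2) →ₗ[ℂ]
    SiteL2K ℂ (F.P K).d (fun _ => (F.P K).sitesPerDir 0) (c0Rec F K (k + 1)) (WRec 2)}
  {Δ2 : BondL2K ℂ (F.P K).d (fun _ => (F.P K).sitesPerDir 0) (c0Rec F K (k + 1)) (WRec 2) →ₗ[ℂ]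
    BondL2K ℂ (F.P K).d (fun _ => (F.P K).sitesPerDir 0) (c0Rec F K (k + 1)) (WRec 2)} (a : ℝ)
  (hposπ : ∀ x, x ≠ 0 → 0 < RCLike.re ⟪x, laplaceAOfRecordAt F 2 (k + 1) (1 : GaugeField (F.P K) 0 (SU 2))
    (hessOpOfRecord128 F 2 (k + 1) (1 : GaugeField (F.P K) 0 (SU 2)) Gp (QflatOfRecord F 2 (k + 1)) Δ2)
    (QOfRecord F 2 (k + 1) (1 : GaugeField (F.P K) 0 (SU 2))) (QflatOfRecord F 2 (k + 1)) a x⟫_ℂ)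
  (hposb : ∀ x, x ≠ 0 → 0 < RCLike.re ⟪x, laplaceAOfRecord F 2 (k + 1) (1 : GaugeField (F.P K) 0 (SU 2))
    (QOfRecord F 2 (k + 1) (1 : GaugeField (F.P K) 0 (SU 2))) (QflatOfRecord F 2 (k + 1)) a x⟫_ℂ)
  (hQ : Function.Surjective (QOfRecord F 2 (k + 1) (1 : GaugeField (F.P K) 0 (SU 2)))) (εC B₀ C₄ a₃ j a𝔄 ε₄ : ℝ) {b C₂ c₄ aC : ℝ}
  (RC : Regime (H1OfRecordAtBgFlat F 2 K (k + 1) Ω 1 levB a hposb hQ) 0 (CslOfRecord F 2 K (k + 1) Ω 1 levB) b 0 C₂ c₄ 0 aC εC)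
  (hCreal : ∀ A : Space115Lit F 2 K (k + 1) Ω 1,
    ((JetSup.equiv _ _ (nabla115 ((F.P K).eta (k + 1)) (unitsOfRecord F 2 (1 : GaugeField (F.P K) 0 (SU 2))))).symm
        (star (JetSup.equiv _ _ (nabla115 ((F.P K).eta (k + 1)) (unitsOfRecord F 2 (1 : GaugeField (F.P K) 0 (SU 2)))) A)) : Space115Lit F 2 K (k + 1) Ω 1) = A →
    ‖A‖ ≤ εC + aC → ((NegSup.equiv _ _).symm (star (NegSup.equiv _ _ (CslOfRecord F 2 K (k + 1) Ω 1 levB A))) :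
      NegSize (F.L : ℝ) ((F.P K).eta (k + 1)) levB 0 (Matrix (Fin 2) (Fin 2) ℂ)) = CslOfRecord F 2 K (k + 1) Ω 1 levB A)
  (hCtr : ∀ A : Space115Lit F 2 K (k + 1) Ω 1,
    ((JetSup.equiv _ _ (nabla115 ((F.P K).eta (k + 1)) (unitsOfRecord F 2 (1 : GaugeField (F.P K) 0 (SU 2))))).symm
        (star (JetSup.equiv _ _ (nabla115 ((F.P K).eta (k + 1)) (unitsOfRecord F 2 (1 : GaugeField (F.P K) 0 (SU 2)))) A)) : Space115Lit F 2 K (k + 1) Ω 1) = A →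
    (∀ b', (JetSup.equiv _ _ (nabla115 ((F.P K).eta (k + 1)) (unitsOfRecord F 2 (1 : GaugeField (F.P K) 0 (SU 2)))) A b').trace = 0) →
    ‖A‖ ≤ εC + aC → ∀ c, (NegSup.equiv _ _ (CslOfRecord F 2 K (k + 1) Ω 1 levB A) c).trace = 0)

include RC hCreal hCtr in
set_option maxHeartbeats 1600000 in
/-- ★★ **BOTH ANALYTIC LETTERS OF THE (R-a) ROAD AT THE FLAT SCHEME OF RECORD** (`N = 2`): `hWtok : WAnalyticTok …` AND `htok : ∀ᶠ B in 𝓝 0, S.LieTokAt (W_B)` from ONE displayed Sect. C package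
(`Regime H♭ 0 C^{𝔰𝔩} …`, `Prop4Hyp`, `a₃ ≤ a_C`, `hCreal`, `hCtr`), the `G′` row, `Delta2Tok ∧ Delta2SymmTok`, Prop. 6's `RegimeTok`, `dom ∈ 𝓝 1` and the chart letter.
[cite: Balaban1985Variational, Prop. 4 p.292, Prop. 6 p.295, (15) p.280; Balaban1985BackgroundPropagators, (3.134) p.422] -/
theorem htok_and_hWtok_ofRecord_two_of_tok
    (hGpR : ∀ s, Gp (starW (phiRec 2) s) = starW (phiRec 2) (Gp s)) (hGpS : ∀ s, Gp (scalPartW 2 _ s) = scalPartW 2 _ (Gp s))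
    (hΔ : Delta2Tok F 2 K (k + 1) Ω 1 levB a hposb hQ Δ2) (hs : Delta2SymmTok F 2 K (k + 1) Ω 1 Δ2)
    (hP : Prop4Hyp (CslOfRecord F 2 K (k + 1) Ω 1 levB) C₂ c₄) (haC : a₃ ≤ aC)
    (hT : (bgSchemeOfRecord F 2 K (k + 1) Ω 1 dom levB Gp Δ2 a hposπ hposb hQ εC B₀ C₄ a₃ j a𝔄 ε₄).RegimeTok)
    (hd : dom ∈ 𝓝 (1 : GaugeField (F.P K) (k + 1) (SU 2)))
    (hρ : letI := θ.instVβ₁; letI := θ.instVβ₂; ∀ v : θ.Vβ, exp (θ.ρ8 v) ∈ Matrix.specialUnitaryGroup (Fin 2) ℂ) :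
    WAnalyticTok F 2 K (k + 1) Ω 1 levB Gp a hposb hQ εC a₃ ∧
    letI := θ.instVβ₁; letI := θ.instVβ₂
    ∀ᶠ B in 𝓝 (0 : Fin (F.P K).d → Site (F.P K) (k + 1) → θ.Vβ),
      (bgSchemeOfRecord F 2 K (k + 1) Ω 1 dom levB Gp Δ2 a hposπ hposb hQ εC B₀ C₄ a₃ j a𝔄 ε₄).LieTokAt (unitField F θ k K B) :=
  ⟨wAnalyticTok_of_sectCRegime F 2 K (k + 1) Ω 1 levB Gp a hposb hQ εC a₃ RC hP haC,
    eventually_lieTokAt_unitField_ofRecord_two_of_tok F θ k K Ω dom levB a hposπ hposb hQ εC B₀ C₄ a₃ j a𝔄 ε₄ RC hCreal hCtr hGpR hGpS hΔ hs hP haC hT hd hρ⟩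

end Record

/-! ## §3  The `G′` row discharged for print's concrete `G′` -/

section PrintGreen

variable (F : T4Family) (θ : Stage13Params F 2) (k K : ℕ) [Fact (0 < (F.L : ℝ))] [Fact (0 < (F.P K).eta (k + 1))] [Fact (0 < c0Rec F K (k + 1))]
  [Fact (∀ c, 0 < wBRec F K (k + 1) c)]
  (Ω : ℕ → Set (Site (F.P K) 0)) (dom : Set (GaugeField (F.P K) (k + 1) (SU 2))) (levB : PBond (F.P K) (k + 1) → ℕ) (a' : ℝ)
  (hpos' : haveI : CompleteSpace ↥(LinearMap.ker (QflatOfRecord F 2 (K := K) (k + 1)))ᗮ := FiniteDimensional.complete ℂ _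
    ∀ x, x ≠ 0 → 0 < RCLike.re ⟪x, (covLaplaceSiteK (c₀ := c0Rec F K (k + 1)) (cRec F K (k + 1)) (RRec F 2 (1 : GaugeField (F.P K) 0 (SU 2)))
      (SRec F 2 (1 : GaugeField (F.P K) 0 (SU 2))) +
      (a' : ℂ) • ((LinearMap.ker (QflatOfRecord F 2 (K := K) (k + 1)))ᗮ.starProjection : _ →L[ℂ] _).toLinearMap) x⟫_ℂ)
  {Δ2 : BondL2K ℂ (F.P K).d (fun _ => (F.P K).sitesPerDir 0) (c0Rec F K (k + 1)) (WRec 2) →ₗ[ℂ]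
    BondL2K ℂ (F.P K).d (fun _ => (F.P K).sitesPerDir 0) (c0Rec F K (k + 1)) (WRec 2)} (a : ℝ)
  (hposπ : haveI : CompleteSpace ↥(LinearMap.ker (QflatOfRecord F 2 (K := K) (k + 1)))ᗮ := FiniteDimensional.complete ℂ _
    ∀ x, x ≠ 0 → 0 < RCLike.re ⟪x, laplaceAOfRecordAt F 2 (k + 1) (1 : GaugeField (F.P K) 0 (SU 2))
    (hessOpOfRecord128 F 2 (k + 1) (1 : GaugeField (F.P K) 0 (SU 2)) (greenK _ hpos') (QflatOfRecord F 2 (k + 1)) Δ2)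
    (QOfRecord F 2 (k + 1) (1 : GaugeField (F.P K) 0 (SU 2))) (QflatOfRecord F 2 (k + 1)) a x⟫_ℂ)
  (hposb : ∀ x, x ≠ 0 → 0 < RCLike.re ⟪x, laplaceAOfRecord F 2 (k + 1) (1 : GaugeField (F.P K) 0 (SU 2))
    (QOfRecord F 2 (k + 1) (1 : GaugeField (F.P K) 0 (SU 2))) (QflatOfRecord F 2 (k + 1)) a x⟫_ℂ)
  (hQ : Function.Surjective (QOfRecord F 2 (k + 1) (1 : GaugeField (F.P K) 0 (SU 2)))) (εC B₀ C₄ a₃ j a𝔄 ε₄ : ℝ) {b C₂ c₄ aC : ℝ}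
  (RC : Regime (H1OfRecordAtBgFlat F 2 K (k + 1) Ω 1 levB a hposb hQ) 0 (CslOfRecord F 2 K (k + 1) Ω 1 levB) b 0 C₂ c₄ 0 aC εC)
  (hCreal : ∀ A : Space115Lit F 2 K (k + 1) Ω 1,
    ((JetSup.equiv _ _ (nabla115 ((F.P K).eta (k + 1)) (unitsOfRecord F 2 (1 : GaugeField (F.P K) 0 (SU 2))))).symm
        (star (JetSup.equiv _ _ (nabla115 ((F.P K).eta (k + 1)) (unitsOfRecord F 2 (1 : GaugeField (F.P K) 0 (SU 2)))) A)) : Space115Lit F 2 K (k + 1) Ω 1) = A →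
    ‖A‖ ≤ εC + aC → ((NegSup.equiv _ _).symm (star (NegSup.equiv _ _ (CslOfRecord F 2 K (k + 1) Ω 1 levB A))) :
      NegSize (F.L : ℝ) ((F.P K).eta (k + 1)) levB 0 (Matrix (Fin 2) (Fin 2) ℂ)) = CslOfRecord F 2 K (k + 1) Ω 1 levB A)
  (hCtr : ∀ A : Space115Lit F 2 K (k + 1) Ω 1,
    ((JetSup.equiv _ _ (nabla115 ((F.P K).eta (k + 1)) (unitsOfRecord F 2 (1 : GaugeField (F.P K) 0 (SU 2))))).symm
        (star (JetSup.equiv _ _ (nabla115 ((F.P K).eta (k + 1)) (unitsOfRecord F 2 (1 : GaugeField (F.P K) 0 (SU 2)))) A)) : Space115Lit F 2 K (k + 1) Ω 1) = A →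
    (∀ b', (JetSup.equiv _ _ (nabla115 ((F.P K).eta (k + 1)) (unitsOfRecord F 2 (1 : GaugeField (F.P K) 0 (SU 2)))) A b').trace = 0) →
    ‖A‖ ≤ εC + aC → ∀ c, (NegSup.equiv _ _ (CslOfRecord F 2 K (k + 1) Ω 1 levB A) c).trace = 0)

include RC hCreal hCtr in
set_option maxHeartbeats 1600000 in
/-- ★★ **THE EVENTUAL LIE TOKEN WITH THE `G′` ROW DISCHARGED FOR PRINT'S CONCRETE `G′ = (Δ_{U₀} + a′·proj_{N(Q′♭)ᗮ})⁻¹`** (real ✓`printGreenOfRecord_starW`, `S`-commuting ✓`scalPartW_printGreenOfRecord`),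
`U₀ = 1`, `N = 2`, `Δ2` via its tokens; Sect. C rows, `RegimeTok`, `dom ∈ 𝓝 1`, chart letter displayed. [cite: Balaban1985BackgroundPropagators, (3.24)–(3.25) p.394, (3.134) p.422; Balaban1985Variational, Prop. 6 p.295, (15) p.280] -/
theorem eventually_lieTokAt_unitField_ofRecord_two_printGreen
    (hΔ : Delta2Tok F 2 K (k + 1) Ω 1 levB a hposb hQ Δ2) (hs : Delta2SymmTok F 2 K (k + 1) Ω 1 Δ2)
    (hP : Prop4Hyp (CslOfRecord F 2 K (k + 1) Ω 1 levB) C₂ c₄) (haC : a₃ ≤ aC)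
    (hT : haveI : CompleteSpace ↥(LinearMap.ker (QflatOfRecord F 2 (K := K) (k + 1)))ᗮ := FiniteDimensional.complete ℂ _
      (bgSchemeOfRecord F 2 K (k + 1) Ω 1 dom levB (greenK _ hpos') Δ2 a hposπ hposb hQ εC B₀ C₄ a₃ j a𝔄 ε₄).RegimeTok)
    (hd : dom ∈ 𝓝 (1 : GaugeField (F.P K) (k + 1) (SU 2)))
    (hρ : letI := θ.instVβ₁; letI := θ.instVβ₂; ∀ v : θ.Vβ, exp (θ.ρ8 v) ∈ Matrix.specialUnitaryGroup (Fin 2) ℂ) :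
    letI := θ.instVβ₁; letI := θ.instVβ₂
    haveI : CompleteSpace ↥(LinearMap.ker (QflatOfRecord F 2 (K := K) (k + 1)))ᗮ := FiniteDimensional.complete ℂ _
    ∀ᶠ B in 𝓝 (0 : Fin (F.P K).d → Site (F.P K) (k + 1) → θ.Vβ),
      (bgSchemeOfRecord F 2 K (k + 1) Ω 1 dom levB (greenK _ hpos') Δ2 a hposπ hposb hQ εC B₀ C₄ a₃ j a𝔄 ε₄).LieTokAt (unitField F θ k K B) := by
  haveI : CompleteSpace ↥(LinearMap.ker (QflatOfRecord F 2 (K := K) (k + 1)))ᗮ := FiniteDimensional.complete ℂ _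
  haveI : (LinearMap.ker (QflatOfRecord F 2 (K := K) (k + 1))).HasOrthogonalProjection :=
    haveI : CompleteSpace ↥(LinearMap.ker (QflatOfRecord F 2 (K := K) (k + 1))) := FiniteDimensional.complete ℂ _
    inferInstance
  have hGpR := printGreenOfRecord_starW F 2 (k + 1) (1 : GaugeField (F.P K) 0 (SU 2)) a' hpos'
  have hGpS := scalPartW_printGreenOfRecord F 2 (k + 1) (1 : GaugeField (F.P K) 0 (SU 2)) a' hpos'
  exact eventually_lieTokAt_unitField_ofRecord_two_of_tok F θ k K Ω dom levB a hposπ hposb hQ εC B₀ C₄ a₃ j a𝔄 ε₄ RC hCreal hCtr hGpR hGpS hΔ hs hP haC hT hd hρ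

end PrintGreen

end Summit.QuantumFields.YangMills.Theorems.N07WAnalyticTokOfSectC

end
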